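import Summits.RiemannHypothesis.RiemannHypothesis.Theses.LiPrimeEcho
import Summits.RiemannHypothesis.RiemannHypothesis.Theorems.LiPrimeEchoHorizontalEdges
import Summits.RiemannHypothesis.RiemannHypothesis.Theorems.LiPrimeEchoPolarEdge
import Summits.RiemannHypothesis.RiemannHypothesis.Theorems.LiPrimeEchoWindowAdjust
import Summits.RiemannHypothesis.RiemannHypothesis.Theorems.LiCoefficientsLiBoxSplitPair
import Literature.NumberTheory.LFunctions.WeilExplicitRightEdge
import Literature.Analysis.SpecialFunctions.DigammaLogBound
import Mathlib.Analysis.Complex.CauchyIntegral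
import HarnessLib

/-!
# RiemannHypothesis / LiPrimeEcho — crux K4 `LiGammaShift`: the gamma edge IS the smooth mean, up to `O(log n)` (RH-FREE)

RH-FREE [rh-li-prover].  Route `Theses/LiPrimeEcho.lean` (rung «Li PRIME-ECHO LAW» `LiTheory.LiZeroWindowEcho`, L-P(P1e);
cell `pub/rh-li`, theory memo `theory/TARGETS.md` §7.10 step D / §12), item `LiGammaShift` (stmt-RiemannHypothesis-19247):
for `c ≥ 1` there are `N`, `C` such that for `n ≥ N`, `√n ≤ T₁ < T₂ ≤ c√n + 1`,

  `|liGammaEdge n T₁ T₂ − liSmoothTraceWindow n T₁ T₂| ≤ C log n`.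

Proof: CAUCHY on the rectangle `[1/2, 3/2] × [T₁, T₂]` for the analytic integrand
`G(w) = (−½ log π + ½ ψ(w/2)) k_n(w)` (`k_n(w) = F_n(w) + F_n(1 − w)`, no pole since `Im w ≥ T₁ ≥ 1`;
`Complex.integral_boundary_rect_eq_zero_of_differentiableOn`) moves the gamma piece from `Re w = 3/2` to the critical
line, where it is EXACTLY the smooth mean: `k_n(½ + it) = e^{inθ(t)} + e^{−inθ(t)} = 2cos(nθ(t))`
(`BoxSplit.one_sub_inv_eq_exp`) and `Re(−½ log π + ½ ψ(¼ + it/2)) = ϑ'(t) = liGammaDensity t`; the two horizontal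
connectors have length `1` and integrand `≤ (½ log(T + 4) + 5)(1 + e)` (`norm_digamma_le_log_height`, `|F_n(w)| ≤ e`,
`|F_n(1 − w)| ≤ e` for `Re w, Re(1 − w) ≥ −½`, `Im w ≥ √n`: `HorizontalEdges.norm_liWeight_le_exp`), which is
`O(log n)` on the window.  Nothing about the zeros at all; nothing here bears on the truth of RH.
-/

noncomputable section

-- D-0017: `Summit.<S>.<S>.…` is the designed namespace of a single-problem summit.
set_option linter.dupNamespace false

open Complex MeasureTheory intervalIntegral Set
open scoped Real Interval ComplexConjugate

namespace Summit.RiemannHypothesis.RiemannHypothesis.Theorems.LiTheory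

open Literature.NumberTheory.LFunctions

namespace GammaShift

/-- The gamma-edge integrand `G_n(w) = (−½ log π + ½ ψ(w/2)) k_n(w)`. -/
def gammaIntegrand (n : ℕ) (w : ℂ) : ℂ :=
  (-(Real.log Real.pi : ℂ) / 2 + 1 / 2 * Complex.digamma (w / 2)) * liSymWeight n w

/-! ### Analyticity on the strip -/

/-- `F_n` is differentiable away from `0`. -/
theorem differentiableAt_liWeight (n : ℕ) {w : ℂ} (hw : w ≠ 0) : DifferentiableAt ℂ (liWeight n) w := by
  unfold liWeight
  exact ((differentiableAt_const _).sub ((differentiableAt_const _).div differentiableAt_id hw)).pow n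

/-- `G_n` is differentiable at every `w` with `Re w > 0`, `w ≠ 1`, `1 − w ≠ 0`… concretely at `Im w ≠ 0`, `Re w > 0`. -/
theorem differentiableAt_gammaIntegrand (n : ℕ) {w : ℂ} (hre : 0 < w.re) (him : w.im ≠ 0) :
    DifferentiableAt ℂ (gammaIntegrand n) w := by
  have hw0 : w ≠ 0 := fun h ↦ him (by simp [h])
  have hw1 : (1 : ℂ) - w ≠ 0 := by
    intro h; apply him
    have := congrArg Complex.im h; simpa using this.symm
  have hψ : DifferentiableAt ℂ (fun z : ℂ ↦ Complex.digamma (z / 2)) w := by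
    have hmem : w / 2 ∈ {s : ℂ | 0 < s.re} := by simp; positivity
    have hd := Literature.Analysis.SpecialFunctions.Complex.differentiableOn_digamma.differentiableAt
      ((isOpen_lt continuous_const Complex.continuous_re).mem_nhds hmem)
    exact hd.comp w (differentiableAt_id.div_const 2)
  have hk : DifferentiableAt ℂ (liSymWeight n) w := by
    unfold liSymWeight
    refine (differentiableAt_liWeight n hw0).add ?_
    exact (differentiableAt_liWeight n hw1).comp w ((differentiableAt_const _).sub differentiableAt_id)
  unfold gammaIntegrand
  exact ((differentiableAt_const _).add ((differentiableAt_const _).mul hψ)).mul hk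

/-- `G_n` is differentiable on every rectangle `[a, b] × [T₁, T₂]` with `a > 0`, `T₁ > 0`. -/
theorem differentiableOn_gammaIntegrand (n : ℕ) {a b T₁ T₂ : ℝ} (ha : 0 < a) (hab : a ≤ b) (hT₁ : 0 < T₁)
    (hT : T₁ ≤ T₂) : DifferentiableOn ℂ (gammaIntegrand n) ([[a, b]] ×ℂ [[T₁, T₂]]) := by
  intro w hw
  rw [uIcc_of_le hab, uIcc_of_le hT, Complex.mem_reProdIm] at hw
  exact (differentiableAt_gammaIntegrand n (ha.trans_le hw.1.1) (by linarith [hw.2.1])).differentiableWithinAt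

/-! ### The critical line: `G_n(½ + it)` has real part `2cos(nθ(t)) ϑ'(t)` -/

/-- `k_n(½ + it) = 2 cos(nθ(t))` (`t ≠ 0`). -/
theorem liSymWeight_half_line (n : ℕ) {t : ℝ} (ht : t ≠ 0) :
    liSymWeight n (1 / 2 + t * I) = ((2 * Real.cos (n * liZeroAngle t) : ℝ) : ℂ) := by
  set s : ℂ := 1 / 2 + t * I with hs
  have hre : s.re = 1 / 2 := by simp [hs]
  have hsim : s.im = t := by simp [hs]
  have h1 : 1 - 1 / s = Complex.exp (liZeroAngle t * I) := by
    rw [← hsim]; exact BoxSplit.one_sub_inv_eq_exp hre (by rwa [hsim])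
  have hconj : 1 - s = conj s := by
    apply Complex.ext <;> simp [hs] ; norm_num
  have h2 : 1 - 1 / (1 - s) = Complex.exp (-(liZeroAngle t * I)) := by
    rw [hconj, show (1 : ℂ) - 1 / conj s = conj (1 - 1 / s) by simp [map_sub], h1, ← Complex.exp_conj]
    congr 1
    simp [Complex.conj_ofReal]
  unfold liSymWeight liWeight
  rw [h1, h2, ← Complex.exp_nat_mul, ← Complex.exp_nat_mul, Complex.ofReal_mul, Complex.ofReal_ofNat,
    Complex.ofReal_cos, Complex.two_cos]
  congr 1
  · congr 1; push_cast; ring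
  · congr 1; push_cast; ring

/-- On the critical line the gamma integrand's real part is the smooth density:
`Re G_n(½ + it) = 2cos(nθ(t)) ϑ'(t)` (`t ≠ 0`). -/
theorem re_gammaIntegrand_half_line (n : ℕ) {t : ℝ} (ht : t ≠ 0) :
    (gammaIntegrand n (1 / 2 + t * I)).re = 2 * Real.cos (n * liZeroAngle t) * liGammaDensity t := by
  unfold gammaIntegrand
  rw [liSymWeight_half_line n ht, Complex.re_mul_ofReal]
  have harg : ((1 : ℂ) / 2 + t * I) / 2 = 1 / 4 + (t : ℂ) / 2 * I := by ring
  rw [harg]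
  unfold liGammaDensity
  rw [Complex.digamma_def]
  have hre : (-(Real.log Real.pi : ℂ) / 2 + 1 / 2 * logDeriv Complex.Gamma (1 / 4 + (t : ℂ) / 2 * I)).re =
      -(Real.log Real.pi) / 2 + (logDeriv Complex.Gamma (1 / 4 + (t : ℂ) / 2 * I)).re / 2 := by
    simp [Complex.add_re, Complex.mul_re]
    ring
  rw [hre]
  ring

/-! ### The horizontal connectors -/

/-- `|F_n(1 − w)| ≤ e` for `Re w ≤ 3/2`, `Im w = T > 0`, `T² ≥ n` (conjugation symmetry + `norm_liWeight_le_exp`). -/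
theorem norm_liWeight_one_sub_le (n : ℕ) {x T : ℝ} (hx : x ≤ 3 / 2) (hT : 0 < T) (hn : (n : ℝ) ≤ T ^ 2) :
    ‖liWeight n (1 - (x + T * I))‖ ≤ Real.exp 1 := by
  have h := HorizontalEdges.norm_liWeight_le_exp n (x := 1 - x) (T := T) (by linarith) hT hn
  have hconj : (1 : ℂ) - (x + T * I) = conj (((1 - x : ℝ) : ℂ) + T * I) := by
    apply Complex.ext <;> simp
  have hnorm : ∀ s : ℂ, ‖liWeight n (conj s)‖ = ‖liWeight n s‖ := by
    intro s
    unfold liWeight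
    rw [show (1 : ℂ) - 1 / conj s = conj (1 - 1 / s) by simp [map_sub], ← map_pow, Complex.norm_conj]
  rw [hconj, hnorm]
  simpa using h

/-- On a horizontal connector `x ∈ [1/2, 3/2]`, `T ≥ 1`, `T² ≥ n`: `‖G_n(x + iT)‖ ≤ (log(T + 4)/2 + 5)(1 + e)`. -/
theorem norm_gammaIntegrand_le (n : ℕ) {x T : ℝ} (hx : x ∈ Icc (1 / 2 : ℝ) (3 / 2)) (hT : 1 ≤ T)
    (hn : (n : ℝ) ≤ T ^ 2) :
    ‖gammaIntegrand n (x + T * I)‖ ≤ (Real.log (T + 4) / 2 + 5) * (1 + Real.exp 1) := by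
  have hT0 : 0 < T := by linarith
  set w : ℂ := x + T * I with hw
  -- the digamma factor
  have hψ : ‖-(Real.log Real.pi : ℂ) / 2 + 1 / 2 * Complex.digamma (w / 2)‖ ≤ Real.log (T + 4) / 2 + 5 := by
    have hwre : 0 < (w / 2).re := by simp [hw]; linarith [hx.1]
    have hwim : 1 / 2 ≤ |(w / 2).im| := by
      simp [hw]; rw [abs_of_pos (by positivity)]; linarith
    have hwn : ‖w / 2‖ ≤ T + 3 := by
      rw [norm_div, Complex.norm_two]
      have : ‖w‖ ≤ |x| + |T| := by
        calc ‖w‖ ≤ ‖(x : ℂ)‖ + ‖(T : ℂ) * I‖ := norm_add_le _ _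
          _ = |x| + |T| := by simp
      rw [abs_of_pos hT0, abs_of_pos (by linarith [hx.1])] at this
      linarith [hx.2]
    have hd := norm_digamma_le_log_height hwre hwim hwn
    have hlogπ : ‖-(Real.log Real.pi : ℂ) / 2‖ ≤ 1 := by
      rw [norm_div, norm_neg, Complex.norm_real, Complex.norm_two, Real.norm_eq_abs,
        abs_of_nonneg (Real.log_nonneg (by linarith [Real.pi_gt_three]))]
      have : Real.log Real.pi ≤ 2 := by
        rw [Real.log_le_iff_le_exp Real.pi_pos]
        have h4 : Real.exp 2 = Real.exp 1 * Real.exp 1 := by rw [← Real.exp_add]; norm_num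
        rw [h4]; nlinarith [Real.exp_one_gt_d9, Real.pi_lt_four]
      linarith
    calc ‖-(Real.log Real.pi : ℂ) / 2 + 1 / 2 * Complex.digamma (w / 2)‖
        ≤ ‖-(Real.log Real.pi : ℂ) / 2‖ + ‖(1 / 2 : ℂ) * Complex.digamma (w / 2)‖ := norm_add_le _ _
      _ ≤ 1 + 1 / 2 * (Real.log (T + 4) + 8) := by
          rw [norm_mul]
          gcongr
          simp
      _ = Real.log (T + 4) / 2 + 5 := by ring
  -- the weight factor
  have hk : ‖liSymWeight n w‖ ≤ 1 + Real.exp 1 := by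
    unfold liSymWeight
    refine (norm_add_le _ _).trans (add_le_add ?_ (norm_liWeight_one_sub_le n hx.2 hT0 hn))
    have h := HorizontalEdges.norm_liWeight_le_exp n (x := x) (T := T) (by linarith [hx.1]) hT0 hn
    -- sharper: `|F_n(w)| ≤ 1` for `Re w ≥ 1/2`
    unfold liWeight
    rw [norm_pow]
    refine pow_le_one₀ (norm_nonneg _) ?_
    have hw0 : w ≠ 0 := fun h0 ↦ by have := congrArg Complex.im h0; simp [hw] at this; exact hT0.ne' this
    rw [show (1 : ℂ) - 1 / w = (w - 1) / w by field_simp, norm_div, div_le_one (norm_pos_iff.2 hw0)]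
    have h1 : ‖w - 1‖ ^ 2 ≤ ‖w‖ ^ 2 := by
      rw [Complex.sq_norm, Complex.sq_norm, Complex.normSq_apply, Complex.normSq_apply]
      simp [hw]
      nlinarith [hx.1]
    exact (pow_le_pow_iff_left₀ (norm_nonneg _) (norm_nonneg _) two_ne_zero).1 h1
  unfold gammaIntegrand
  rw [norm_mul]
  have hlog0 : 0 ≤ Real.log (T + 4) := Real.log_nonneg (by linarith)
  exact mul_le_mul hψ hk (norm_nonneg _) (by linarith)

/-- A horizontal connector costs `≤ (log(T + 4)/2 + 5)(1 + e)`: for `T ≥ 1`, `T² ≥ n`,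
`‖∫_{1/2}^{3/2} G_n(x + iT) dx‖ ≤ (log(T + 4)/2 + 5)(1 + e)`. -/
theorem norm_integral_connector_le (n : ℕ) {T : ℝ} (hT : 1 ≤ T) (hn : (n : ℝ) ≤ T ^ 2) :
    ‖∫ x in (1 / 2 : ℝ)..(3 / 2 : ℝ), gammaIntegrand n (x + T * I)‖ ≤ (Real.log (T + 4) / 2 + 5) * (1 + Real.exp 1) := by
  have hpt : ∀ x ∈ Ι (1 / 2 : ℝ) (3 / 2), ‖gammaIntegrand n (x + T * I)‖ ≤ (Real.log (T + 4) / 2 + 5) * (1 + Real.exp 1) := by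
    intro x hx
    rw [uIoc_of_le (by norm_num)] at hx
    exact norm_gammaIntegrand_le n ⟨hx.1.le, hx.2⟩ hT hn
  have h := intervalIntegral.norm_integral_le_of_norm_le_const hpt
  have hlen : |(3 / 2 : ℝ) - 1 / 2| = 1 := by norm_num
  rw [hlen, mul_one] at h
  exact h

/-! ### Cauchy: the right edge equals the critical line plus the connectors -/

/-- For `0 < T₁ ≤ T₂`: `liGammaEdge n T₁ T₂ − liSmoothTraceWindow n T₁ T₂ = (1/π) Im(∫_top − ∫_bot)` where
`∫_top/bot = ∫_{1/2}^{3/2} G_n(x + iT₂/T₁) dx`. -/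
theorem gammaEdge_sub_smooth_eq (n : ℕ) {T₁ T₂ : ℝ} (hT₁ : 0 < T₁) (hT : T₁ ≤ T₂) :
    liGammaEdge n T₁ T₂ - liSmoothTraceWindow n T₁ T₂ =
      1 / Real.pi * ((∫ x in (1 / 2 : ℝ)..(3 / 2 : ℝ), gammaIntegrand n (x + T₂ * I)) -
        ∫ x in (1 / 2 : ℝ)..(3 / 2 : ℝ), gammaIntegrand n (x + T₁ * I)).im := by
  -- Cauchy on the rectangle with corners `1/2 + iT₁`, `3/2 + iT₂`
  have hC := Complex.integral_boundary_rect_eq_zero_of_differentiableOn (gammaIntegrand n) (1 / 2 + T₁ * I)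
    (3 / 2 + T₂ * I) (by
      have h1 : ((1 : ℂ) / 2 + T₁ * I).re = 1 / 2 := by simp
      have h2 : ((3 : ℂ) / 2 + T₂ * I).re = 3 / 2 := by simp
      have h3 : ((1 : ℂ) / 2 + T₁ * I).im = T₁ := by simp
      have h4 : ((3 : ℂ) / 2 + T₂ * I).im = T₂ := by simp
      rw [h1, h2, h3, h4]
      exact differentiableOn_gammaIntegrand n (by norm_num) (by norm_num) hT₁ hT)
  simp only [Complex.add_re, Complex.add_im, Complex.div_ofNat_re, Complex.one_re, Complex.mul_re, Complex.ofReal_re,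
    Complex.I_re, Complex.ofReal_im, Complex.I_im, Complex.div_ofNat_im, Complex.one_im, Complex.mul_im,
    Complex.re_ofNat, Complex.im_ofNat] at hC
  norm_num at hC
  -- `hC : ∫bot − ∫top + I ∫R − I ∫L = 0`
  set IR := ∫ y in T₁..T₂, gammaIntegrand n (3 / 2 + y * I) with hIR
  set IL := ∫ y in T₁..T₂, gammaIntegrand n (1 / 2 + y * I) with hIL
  set Itop := ∫ x in (1 / 2 : ℝ)..(3 / 2 : ℝ), gammaIntegrand n (x + T₂ * I) with hItop
  set Ibot := ∫ x in (1 / 2 : ℝ)..(3 / 2 : ℝ), gammaIntegrand n (x + T₁ * I) with hIbot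
  have hRL : IR = IL - I * (Itop - Ibot) := by
    have hI : I * I = -1 := Complex.I_mul_I
    linear_combination (-I) * hC + (IR - IL) * hI
  -- the right edge is the gamma edge
  have hedge : liGammaEdge n T₁ T₂ = 1 / Real.pi * IR.re := by
    rw [hIR]; rfl
  -- the left edge is the smooth mean
  have hleft : IL.re = ∫ y in T₁..T₂, 2 * Real.cos (n * liZeroAngle y) * liGammaDensity y := by
    have hcont : ContinuousOn (fun y : ℝ ↦ gammaIntegrand n (1 / 2 + y * I)) (uIcc T₁ T₂) := by
      refine continuousOn_of_forall_continuousAt fun y hy ↦ ?_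
      rw [uIcc_of_le hT] at hy
      have hy0 : 0 < y := hT₁.trans_le hy.1
      have hd := differentiableAt_gammaIntegrand n (w := 1 / 2 + y * I) (by simp) (by simp; exact hy0.ne')
      have hc2 : Continuous fun y : ℝ ↦ (1 : ℂ) / 2 + y * I := by fun_prop
      show ContinuousAt ((gammaIntegrand n) ∘ fun y : ℝ ↦ (1 : ℂ) / 2 + y * I) y
      exact ContinuousAt.comp hd.continuousAt hc2.continuousAt
    have hi : IntervalIntegrable (fun y : ℝ ↦ gammaIntegrand n (1 / 2 + y * I)) volume T₁ T₂ :=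
      hcont.intervalIntegrable
    have hcomm := ContinuousLinearMap.intervalIntegral_comp_comm Complex.reCLM hi
    simp only [Complex.reCLM_apply] at hcomm
    rw [hIL, ← hcomm]
    refine intervalIntegral.integral_congr fun y hy ↦ ?_
    rw [uIcc_of_le hT] at hy
    exact re_gammaIntegrand_half_line n (hT₁.trans_le hy.1).ne'
  have hsmooth : liSmoothTraceWindow n T₁ T₂ = 1 / Real.pi * IL.re := by
    unfold liSmoothTraceWindow
    rw [hleft, ← intervalIntegral.integral_const_mul, ← intervalIntegral.integral_const_mul]
    refine intervalIntegral.integral_congr fun y _ ↦ ?_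
    ring
  rw [hedge, hsmooth, hRL]
  simp only [Complex.sub_re, Complex.mul_re, Complex.I_re, Complex.I_im, zero_mul, one_mul, zero_sub]
  ring

end GammaShift

open GammaShift in
/-- **Crux K4 `LiGammaShift` of route `LiPrimeEcho`** (stmt-RiemannHypothesis-19247; RH-FREE): for `c ≥ 1` there are
`N`, `C` with `|liGammaEdge n T₁ T₂ − liSmoothTraceWindow n T₁ T₂| ≤ C log n` whenever `n ≥ N`, `√n ≤ T₁ < T₂ ≤ c√n + 1`.
Verbatim the route statement. -/
theorem liGammaShift_bound :
    ∀ c : ℝ, 1 ≤ c → ∃ N : ℕ, ∃ C : ℝ, ∀ n : ℕ, N ≤ n → ∀ T₁ T₂ : ℝ, Real.sqrt n ≤ T₁ → T₁ < T₂ →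
      T₂ ≤ c * Real.sqrt n + 1 → |liGammaEdge n T₁ T₂ - liSmoothTraceWindow n T₁ T₂| ≤ C * Real.log n := by
  intro c hc
  refine ⟨⌈(c + 5) ^ 2⌉₊, 11 * (1 + Real.exp 1), fun n hn T₁ T₂ hT₁ hT₁₂ hT₂ ↦ ?_⟩
  -- sizes
  have hc5 : (c + 5) ^ 2 ≤ (n : ℝ) := (Nat.le_ceil _).trans (by exact_mod_cast hn)
  set s := Real.sqrt n with hs
  have hn0 : (0 : ℝ) ≤ n := by positivity
  have hss : s ^ 2 = n := by rw [hs, Real.sq_sqrt hn0]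
  have hs6 : c + 5 ≤ s := by
    rw [hs, ← Real.sqrt_sq (by linarith : 0 ≤ c + 5)]; exact Real.sqrt_le_sqrt hc5
  have hs1 : 1 ≤ s := by linarith
  have hT₁1 : 1 ≤ T₁ := hs1.trans hT₁
  have hT₁0 : 0 < T₁ := by linarith
  have hn1 : (n : ℝ) ≤ T₁ ^ 2 := by rw [← hss]; exact pow_le_pow_left₀ (by linarith) hT₁ 2
  have hn2 : (n : ℝ) ≤ T₂ ^ 2 := hn1.trans (pow_le_pow_left₀ hT₁0.le hT₁₂.le 2)
  have htop : T₂ + 4 ≤ n := by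
    have : (c + 5) * s ≤ s * s := mul_le_mul_of_nonneg_right hs6 (by linarith)
    nlinarith
  have hn36 : (36 : ℝ) ≤ n := by nlinarith
  have hlogn1 : 1 ≤ Real.log n := by
    rw [Real.le_log_iff_exp_le (by linarith)]
    have := Real.exp_one_lt_d9; linarith
  have hl2 : Real.log (T₂ + 4) ≤ Real.log n := Real.log_le_log (by linarith) htop
  have hl1 : Real.log (T₁ + 4) ≤ Real.log n := Real.log_le_log (by linarith) (by linarith)
  -- Cauchy
  rw [gammaEdge_sub_smooth_eq n hT₁0 hT₁₂.le, abs_mul, abs_of_pos (by positivity : (0 : ℝ) < 1 / Real.pi)]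
  have htop' := norm_integral_connector_le n (by linarith : (1 : ℝ) ≤ T₂) hn2
  have hbot' := norm_integral_connector_le n hT₁1 hn1
  have him := Complex.abs_im_le_norm
    ((∫ x in (1 / 2 : ℝ)..(3 / 2 : ℝ), gammaIntegrand n (x + T₂ * I)) -
      ∫ x in (1 / 2 : ℝ)..(3 / 2 : ℝ), gammaIntegrand n (x + T₁ * I))
  have hdiff := (him.trans (norm_sub_le _ _)).trans (add_le_add htop' hbot')
  have hπ : 1 / Real.pi ≤ 1 := by rw [div_le_one Real.pi_pos]; linarith [Real.pi_gt_three]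
  have he := Real.exp_pos 1
  calc 1 / Real.pi * |((∫ x in (1 / 2 : ℝ)..(3 / 2 : ℝ), gammaIntegrand n (x + T₂ * I)) -
          ∫ x in (1 / 2 : ℝ)..(3 / 2 : ℝ), gammaIntegrand n (x + T₁ * I)).im|
      ≤ 1 * ((Real.log (T₂ + 4) / 2 + 5) * (1 + Real.exp 1) + (Real.log (T₁ + 4) / 2 + 5) * (1 + Real.exp 1)) :=
        mul_le_mul hπ hdiff (abs_nonneg _) zero_le_one
    _ ≤ 11 * (1 + Real.exp 1) * Real.log n := by nlinarith

/-- **Item `LiGammaShift` of route `LiPrimeEcho`** (stmt-RiemannHypothesis-19247), closed BY NAME. -/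
theorem liGammaShift_proof : Summit.RiemannHypothesis.RiemannHypothesis.Theses.LiPrimeEcho.LiGammaShift :=
  liGammaShift_bound

end Summit.RiemannHypothesis.RiemannHypothesis.Theorems.LiTheory

end
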